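import Summits.QuantumFields.YangMills.Theorems.AlphaInputsT3ACv3Core
import Literature.MathematicalPhysics.QuantumFieldTheory.Balaban1983to89.T3AlphaInputsACSchemas
import HarnessLib

/-!
# `UnitScaleTiltHistoryTailIntData` — crux `HistoryTailL` (stmt-QuantumFields-19936), R-57χ successor line (owner RULING g23-№2 ADD. 5/6, R57chi/README «TO COME …
# (19936 lineage)»): **THE INTERIOR-WINDOW DATUM OF A FAMILY OF DATA CORES** `AlphaInputsT3AC.dataIntV3 (q : ∀ K, PkgCoreV3 F 𝔠 γ hγ hγ1 K) π` and every
# (41)-side row the 19936 consumer cone reads, delivered ONCE over ★alpha-1's row-stable core `AlphaInputsT3AC.PkgCoreV3` (`AlphaInputsT3ACv3Core`) — seat ym3-torus-p2 (g16)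

WHY.  Under the additive repair R-57χ the (α) record's lower row is print's (47) on print's validity family; the 19936 denominator reads it on the INTERIOR field
window `|W(∂p) − 1| < θBal(K−j)/max(B₃,1)` (★alpha-1's `AlphaInputsT3AC.intWindowT3`, `PkgAtV3Chi.le_resDensity_int_ae`).  Everything else the `HistoryTailL` cone
consumes is (41)-side and identical for the old package `PkgAtV3` and the χ-package `PkgAtV3Chi`; both project to the core (`.toCore`).  So the cone is re-delivered
over an ARBITRARY family of cores `q : ∀ K, PkgCoreV3 …` with the datum

  `dataIntV3 q π` := `OfV3At.dataT3v3`'s field table VERBATIM over `q K` EXCEPT `χ K j := 𝟙[PlaqSmall (θBal(K−j)/max(B₃,1))]` (the interior indicator),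

and the only χ-package input — `Ineq47AE (dataIntV3 q π) K j` — enters the final assembly (`UnitScaleTiltHistoryTailLaneTailChi`) as ONE row.  This file: the datum (§1),
the minimiser rows `Constraint42Top`/`Regularity68Levels`/`MainTermIsAction`/`uminTriv`/`AdmOnSmall` (§2), `ChiRange`, `TrivRegions`, `EcstBook`, `RmSize`,
the interior `χ`'s values and `0 < low` on the interior window (§3) — `Ineq41AE`, `Integrable up/low`, `0 < ∫ low`, `EnvelopeRegular` are in `…IntEnvelope`; and the record-free socket
`AlphaInputsT3AC.IntCoreRec L` (§1) the assembly `…LaneTailInt` consumes — proofs = `AlphaInputsT3ACv3Data`'s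
(★alpha-1 g3) with `h.pkgAtV3 hc γ hγ hγ1 K ↦ q K` and the indicator in place of the tower's `χ`.  Nothing of [Balaban1985UV3] is asserted; CONDITIONAL only on the
family `q` (data carrying its rows).

References: T. Bałaban, Commun. Math. Phys. 102 (1985) 255–275 [Balaban1985UV3]; Commun. Math. Phys. 102 (1985) 277–309 [Balaban1985Variational].
-/

set_option autoImplicit false

noncomputable section

namespace Summit.QuantumFields.YangMills.Theorems

open MeasureTheory
open scoped BigOperators
open Literature.MathematicalPhysics.QuantumFieldTheory.Balaban1983to89
open Literature.MathematicalPhysics.QuantumFieldTheory.Balaban1983to89.T3ContinuumYM3Torus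
open Literature.MathematicalPhysics.QuantumFieldTheory.Balaban1983to89.T3UnitLawDensityEML (ℰp)
open Literature.MathematicalPhysics.QuantumFieldTheory.Balaban1983to89.T3UnitScaleTilt (θBal)
open Literature.MathematicalPhysics.QuantumFieldTheory.Balaban1983to89.T3LevelShift (fieldShift)
open Literature.MathematicalPhysics.QuantumFieldTheory.Balaban1983to89.T3PrintedRegularMinimiser (regFibrePr minActionRegPr)
open Literature.MathematicalPhysics.QuantumFieldTheory.Balaban1983to89.T3AlphaInputsAC
open Literature.MathematicalPhysics.QuantumFieldTheory.Balaban1983to89.T3AlphaInputsACSchemas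
open Literature.MathematicalPhysics.QuantumFieldTheory.Balaban1985CMP102
open Literature.MathematicalPhysics.QuantumFieldTheory.Balaban1985CMP102.Setting
open Summit.QuantumFields.Balaban3D.Carriers
open Summit.QuantumFields.Balaban3D.Proofs.Primitives
open Summit.QuantumFields.Balaban3D.Proofs.TowerAC
open Summit.QuantumFields.Balaban3D.Proofs.StandardAC
open Summit.QuantumFields.Balaban3D.Proofs.InputsAC
open Summit.QuantumFields.Balaban3D.Proofs.TowerFactsAC
open Summit.QuantumFields.Balaban3D.Proofs.Inputs (rcoefOf_carrier)
open Summit.QuantumFields.Balaban3D.Proofs.TransportAC (integrable_mul_exp_of_le)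
open Summit.QuantumFields.Balaban3D.Proofs (Bound55Std.measurable_actionEta Bound55Std.actionEta_nonneg)

variable {F : T3Family} {𝔠 : AlphaConsts F.L (suGroupModel 2).N} {γ : ℝ} {hγ : 0 < γ} {hγ1 : γ ≤ (min 𝔠.gamma0 1) ^ 2}

/-! ## §1 The datum -/

/-- **THE INTERIOR-WINDOW DATUM OF A FAMILY OF DATA CORES** `q : ∀ K, PkgCoreV3 F 𝔠 γ hγ hγ1 K`: run-`K` fields := the objects of the AC tower of the core `q K`
(`OfV3At.dataT3v3`'s table: histories/regions the lane's, `Adm := ChargedT3` = print's (40) support, `LF K j W Φ := Σ_h wtP_j(h, W)·e^{Φ h}` with the windowed pinned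
weights, `Umin := U_k(·,h)`, `mainT`/`Pint`/`Zterm`/`Estep`/`Rm` the tower's, `Ecst K j := E_j − E`, polymer fields the parameter `π`) EXCEPT the characteristic function:
`χ K j W := 𝟙[|W(∂p) − 1| < θBal(K−j)/max(B₃,1) ∀ p]` — the indicator of the INTERIOR field window (= ★alpha-1's `intWindowT3 F 𝔠 γ K j`), on which print's (47) holds
for the χ-record ([Balaban1985Variational] Thm 1 (8) puts the datum's minimiser inside print's `χ_k`).  A DEFINITION; nothing is asserted by it.
[cite: Balaban1985UV3, (38)–(43) p.266 + (47) p.267; Balaban1985Variational, Thm 1 (8) p.279] -/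
def AlphaInputsT3AC.dataIntV3 (q : ∀ K, AlphaInputsT3AC.PkgCoreV3 F 𝔠 γ hγ hγ1 K) (π : AlphaInputsT3AC.PolymerT3 F) : AlphaDataT3 F γ where
  Hist := fun K j => Hist (F.P K) j
  triv := fun K j => Hist.triv (F.P K) j
  Ω := fun K j hh i => Omega 𝔠.lane.carrier.M₁
    (rcolOf (T3Scales F γ hγ (hγ1.trans (sq_min_one_le _ 𝔠.gamma0_pos)) K) 𝔠.lane.carrier) j hh i
  Adm := fun K j hh W => ChargedT3 F γ 𝔠.b₀ 𝔠.p₀ (avgWindowFactor F.L) K 𝔠.lane.carrier.M₁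
    (rcolOf (T3Scales F γ hγ (hγ1.trans (sq_min_one_le _ 𝔠.gamma0_pos)) K) 𝔠.lane.carrier) j hh W
  LF := fun K j W Φ => ∑ r : Hist (F.P K) j, (q K).wtP j r W * Real.exp (Φ r)
  Umin := fun K j hh W => (q K).UkH j hh W
  mainT := fun K j hh W => (q K).T.mainT j hh W
  Pint := fun K j hh W => (q K).T.Pint j hh W
  Loc := π.Loc
  Pterm := π.Pterm
  enl := π.enl
  treeLen := π.treeLen
  Zterm := fun K j hh => (q K).T.Zterm j hh
  χ := fun K j W => {V : GaugeField (F.P K) j (Matrix.specialUnitaryGroup (Fin 2) ℂ) |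
      PlaqSmall (θBal F.L γ 𝔠.b₀ 𝔠.p₀ (K - j) / max 𝔠.B₃ 1) V}.indicator (fun _ => (1 : ℝ)) W
  Estep := fun K i => (q K).T.Estep i
  Ecst := fun K j => (q K).T.Ecst j - (q K).E
  Rm := fun K j => (q K).T.Rm j

open Classical in
/-- **THE DATUM WITH `LF` SPLIT AT THE TRIVIAL HISTORY** (structure update of `dataIntV3`, v5p5's STUB 2‴ shape with `wt′ := wtP`): the same function as `dataIntV3.LF`
(`OfV3At.dataT3v3P`'s twin).  A DEFINITION; nothing asserted. [cite: Balaban1985UV3, (41) p.266] -/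
def AlphaInputsT3AC.dataIntV3P (q : ∀ K, AlphaInputsT3AC.PkgCoreV3 F 𝔠 γ hγ hγ1 K) (π : AlphaInputsT3AC.PolymerT3 F) : AlphaDataT3 F γ :=
  { AlphaInputsT3AC.dataIntV3 q π with
    LF := fun K j Wf Φ => (q K).wtP j (Hist.triv (F.P K) j) Wf * Real.exp (Φ (Hist.triv (F.P K) j)) +
      ∑ r ∈ Finset.univ.erase (Hist.triv (F.P K) j), (q K).wtP j r Wf * Real.exp (Φ r) }

open Classical in
/-- **THE INTERFACE'S `LFData` FOR THE DATUM** (`OfV3At.lfDataT3v3`'s twin): region histories := the lane's discrete histories; `trivReg := Hist.triv`; `assemble r v := r`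
(dummy fibre variable); `wt r v W := wtP_j(r, W)` (windowed, pinned); `LargeP r i := P_i(r)` for admissible `r` and `i < j`, else `∅`.  A DEFINITION; nothing asserted.
[cite: Balaban1985UV3, (38)-(41) p.266] -/
def AlphaInputsT3AC.lfDataIntV3 (q : ∀ K, AlphaInputsT3AC.PkgCoreV3 F 𝔠 γ hγ hγ1 K) (π : AlphaInputsT3AC.PolymerT3 F) :
    LFData (AlphaInputsT3AC.dataIntV3 q π) where
  Reg := fun K j => Hist (F.P K) j
  regFintype := fun _ _ => inferInstance
  trivReg := fun K j => Hist.triv (F.P K) j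
  assemble := fun _ _ r _ => r
  wt := fun K j r _ W => (q K).wtP j r W
  LargeP := fun K j r i =>
    if hij : i < j ∧ Hist.Admissible 𝔠.lane.carrier.M₁
        (rcolOf (T3Scales F γ hγ (hγ1.trans (sq_min_one_le _ 𝔠.gamma0_pos)) K) 𝔠.lane.carrier) j r
    then r ⟨i, hij.1⟩ else ∅

/-- **THE RECORD-FREE 19936 SOCKET AT BLOCK SIZE `L`** (the shape `…HistoryTailLaneTailInt.historyTailL_of_intCoreRec` consumes; the χ-record `AlphaInputsT3ACv3RecChi L` of
R-57χ is an instance, `…HistoryTailLaneTailChi`): thresholds `b₁, p₁` such that for every profile `(b₀, p₀)` beyond them there is a primitive-constants record `𝔠` with EXACTLY that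
p-function and a [Balaban1985Variational] constant `a₁ > 0` such that every three-torus family of block size `L`, at every admissible coupling, carries a family of data cores
`qf : ∀ K, PkgCoreV3 …` with constant `a₁` whose INTERIOR datum satisfies the lower a.e. row (47)′ at every level `j ≤ K` once `θBal ≤ a₁` (the data-smallness binder of Thm 1 (8)).
OPEN hypothesis schema, never asserted. [cite: Balaban1985UV3, (7) p.257, (47) p.267 and Thm 2 p.272; Balaban1985Variational, Thm 1 (8) p.279] -/
def AlphaInputsT3AC.IntCoreRec (L : ℕ) : Prop :=
  ∃ (b₁ p₁ : ℝ), ∀ (b₀ p₀ : ℝ), b₁ ≤ b₀ → p₁ ≤ p₀ →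
    ∃ (𝔠 : AlphaConsts L (suGroupModel 2).N) (a₁ : ℝ), 𝔠.b₀ = b₀ ∧ 𝔠.p₀ = p₀ ∧ 0 < a₁ ∧
      ∀ (F : T3Family) (hF : F.L = L) (γ : ℝ) (hγ : 0 < γ) (hγ1 : γ ≤ (min (hF ▸ 𝔠).gamma0 1) ^ 2),
        ∃ qf : ∀ K, AlphaInputsT3AC.PkgCoreV3 F (hF ▸ 𝔠) γ hγ hγ1 K, (∀ K, (qf K).a₁ = a₁) ∧
          ((∀ i, θBal F.L γ (hF ▸ 𝔠).b₀ (hF ▸ 𝔠).p₀ i ≤ a₁) →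
            ∀ (π : AlphaInputsT3AC.PolymerT3 F) (K j : ℕ), j ≤ K → Ineq47AE (AlphaInputsT3AC.dataIntV3 qf π) K j)

section Delivered

variable (q : ∀ K, AlphaInputsT3AC.PkgCoreV3 F 𝔠 γ hγ hγ1 K) (π : AlphaInputsT3AC.PolymerT3 F)

/-- The majorant of the datum is the windowed pinned history sum: `up_j(W) = Σ_h wtP_j(h, W)·exp(−mainT_j(h,W) + Pint_j(h,W) + Zterm_j(h))`. [folklore] -/
theorem AlphaInputsT3AC.dataIntV3_up_eq (K j : ℕ) (W : GaugeField (F.P K) j (Matrix.specialUnitaryGroup (Fin 2) ℂ)) :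
    (AlphaInputsT3AC.dataIntV3 q π).up K j W = ∑ r : Hist (F.P K) j, (q K).wtP j r W *
      Real.exp (-((q K).T.mainT j r W) + (q K).T.Pint j r W + (q K).T.Zterm j r) :=
  rfl

/-- The minorant of the datum: `low_j(W) = 𝟙[interior_j](W)·exp(−mainT_j(triv,W) + Pint_j(triv,W))`. [folklore] -/
theorem AlphaInputsT3AC.dataIntV3_low_eq (K j : ℕ) (W : GaugeField (F.P K) j (Matrix.specialUnitaryGroup (Fin 2) ℂ)) :
    (AlphaInputsT3AC.dataIntV3 q π).low K j W =
      {V : GaugeField (F.P K) j (Matrix.specialUnitaryGroup (Fin 2) ℂ) |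
          PlaqSmall (θBal F.L γ 𝔠.b₀ 𝔠.p₀ (K - j) / max 𝔠.B₃ 1) V}.indicator (fun _ => (1 : ℝ)) W *
        Real.exp (-((q K).T.mainT j (Hist.triv (F.P K) j) W) + (q K).T.Pint j (Hist.triv (F.P K) j) W) :=
  rfl

/-! ## §2 The minimiser rows delivered -/

/-- **`Constraint42Top` — PROVED from r2** (core field `minRows`). [cite: Balaban1985UV3, (42) p.266 and (67) p.273] -/
theorem AlphaInputsT3AC.dataIntV3_constraint42Top : Constraint42Top (AlphaInputsT3AC.dataIntV3 q π) :=
  fun K j hh W hj hadm b hb => (q K).minRows.2.1 j hj hh W hadm b hb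

/-- **`Regularity68Levels` — PROVED from r3** (core field `minRows`). [cite: Balaban1985UV3, (68) p.273] -/
theorem AlphaInputsT3AC.dataIntV3_regularity68Levels : Regularity68Levels (AlphaInputsT3AC.dataIntV3 q π) 𝔠.b₀ 𝔠.p₀ 𝔠.C68 :=
  fun K j hh W hj hadm i hi s hs p hp => (q K).minRows.2.2 j hj hh W hadm i hi s hs p hp

/-- **`Regularity68`** (the `s = 0` instance). [cite: Balaban1985UV3, (68) p.273] -/
theorem AlphaInputsT3AC.dataIntV3_regularity68 : Regularity68 (AlphaInputsT3AC.dataIntV3 q π) 𝔠.b₀ 𝔠.p₀ 𝔠.C68 :=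
  regularity68_of_levels (AlphaInputsT3AC.dataIntV3_regularity68Levels q π)

/-- **`MainTermIsAction`** — EXACT (`mainT_towerOfAC_T3_eq`). [cite: Balaban1985UV3, (5) p.256 and (41) p.266] -/
theorem AlphaInputsT3AC.dataIntV3_mainTermIsAction : MainTermIsAction (AlphaInputsT3AC.dataIntV3 q π) :=
  fun K j hh W => mainT_towerOfAC_T3_eq 𝔠.lane (q K).X (q K).𝔖 j hh W

/-- `ε₁(j) = θBal(K − j)` for the core's inputs, `j ≤ K` (`PkgAtV3.eps1_eq`'s proof, read off the fields). [cite: Balaban1985UV3, (7) p.257] -/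
theorem AlphaInputsT3AC.dataIntV3_eps1_eq (K j : ℕ) (hj : j ≤ K) :
    (inputOfAC 𝔠.lane (q K).X (q K).𝔖).ε₁ j = θBal F.L γ 𝔠.b₀ 𝔠.p₀ (K - j) := by
  show (T3Scales F γ hγ (hγ1.trans (sq_min_one_le _ 𝔠.gamma0_pos)) K).gk j *
      B10.pFun 𝔠.b₀ 𝔠.p₀ ((T3Scales F γ hγ (hγ1.trans (sq_min_one_le _ 𝔠.gamma0_pos)) K).gk j) = _
  rw [T3Scales_gk_eq F γ hγ _ K j hj]
  rfl

include q in
/-- `0 < θBal(K − j)` for `j ≤ K` (`= ε₁(j) > 0`). [cite: Balaban1985UV3, (7) p.257] -/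
theorem AlphaInputsT3AC.dataIntV3_θBal_pos (K j : ℕ) (hj : j ≤ K) : 0 < θBal F.L γ 𝔠.b₀ 𝔠.p₀ (K - j) := by
  rw [← AlphaInputsT3AC.dataIntV3_eps1_eq q K j hj]
  exact eps1_inputOfAC_pos 𝔠.lane (q K).X (q K).𝔖 j hj

/-- **THE `UminTrivIsRegMinimiser` CLAUSES AT A HEIGHT `n < K` — PROVED from r1** under the [7] bookkeeping against the member's OWN constants
`θBal(n) ≤ (q K).a₁`, `B₃θBal(n) ≤ ε₀ ≤ (q K).a₀`. [cite: Balaban1985Variational, Thm 1 (8) p.279 and Prop 7 p.299] -/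
theorem AlphaInputsT3AC.dataIntV3_uminTriv (K n : ℕ) (hnK : n < K) (ε₀ : ℝ)
    (ha₁ : θBal F.L γ 𝔠.b₀ 𝔠.p₀ n ≤ (q K).a₁) (hlo : 𝔠.B₃ * θBal F.L γ 𝔠.b₀ 𝔠.p₀ n ≤ ε₀) (hhi : ε₀ ≤ (q K).a₀)
    (V : GaugeField (F.P n) 0 (Matrix.specialUnitaryGroup (Fin 2) ℂ)) (hV : PlaqSmall (θBal F.L γ 𝔠.b₀ 𝔠.p₀ n) V) :
    (AlphaInputsT3AC.dataIntV3 q π).Umin K (K - n) ((AlphaInputsT3AC.dataIntV3 q π).triv K (K - n))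
        (fieldShift (F.sitesPerDir_eq (m := F.m) (K := K) (j := K - n) (m' := F.m) (K' := n) (j' := 0) (by omega)) V) ∈
      regFibrePr F n K hnK.le ε₀ V ∧
    wilsonAction4 ((AlphaInputsT3AC.dataIntV3 q π).Umin K (K - n) ((AlphaInputsT3AC.dataIntV3 q π).triv K (K - n))
        (fieldShift (F.sitesPerDir_eq (m := F.m) (K := K) (j := K - n) (m' := F.m) (K' := n) (j' := 0) (by omega)) V)) =
      minActionRegPr F n K hnK.le ε₀ V := by
  have hθ : 0 < θBal F.L γ 𝔠.b₀ 𝔠.p₀ n := by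
    have := AlphaInputsT3AC.dataIntV3_θBal_pos q K (K - n) (by omega)
    rwa [show K - (K - n) = n by omega] at this
  have hmem := T3PrintedMinimiserExistence.regFibrePr_mono F hlo V ((q K).minRows.1 n hnK _ ε₀ hθ ha₁ hlo hhi V hV).1
  exact ⟨hmem, T3PrintedMinimiserExistence.minActionRegPr_eq_of_isMinOn F hmem ((q K).minRows.1 n hnK _ ε₀ hθ ha₁ hlo hhi V hV).2⟩

/-- **`AdmOnSmall` AT THE RECORD'S `b₀, p₀` — PROVED** (`OfV3At.dataT3v3_admOnSmall`'s proof). [cite: Balaban1985UV3, (40) p.266 and (47) p.267] -/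
theorem AlphaInputsT3AC.dataIntV3_admOnSmall : AdmOnSmall (AlphaInputsT3AC.dataIntV3 q π) 𝔠.b₀ 𝔠.p₀ := by
  intro K j W _ hW
  refine ⟨Hist.admissible_triv _ _ j, fun p _ => (hW p).trans_le ?_⟩
  have hγ1' : γ ≤ 1 := hγ1.trans (sq_min_one_le _ 𝔠.gamma0_pos)
  have hmono := θBal_le_two_mul_sq_mul_θBal_succ (le_of_lt F.hL.2) hγ hγ1' 𝔠.b₀_pos 𝔠.p₀_pos.le (K - j)
  have hθ : 0 ≤ θBal F.L γ 𝔠.b₀ 𝔠.p₀ (K - j + 1) :=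
    (T3MinimiserStabilityReduction.θBal_pos (le_of_lt F.hL.2) hγ hγ1' 𝔠.b₀_pos 𝔠.p₀ (K - j + 1)).le
  have hB : 1 ≤ avgWindowFactor F.L := by
    unfold avgWindowFactor
    have hL : (1 : ℝ) ≤ F.L := by exact_mod_cast (le_of_lt F.hL.2)
    have h5 : (0 : ℝ) ≤ (((3 + 2) * F.L : ℕ) : ℝ) ^ 2 := sq_nonneg _
    nlinarith
  have hL2 : (0 : ℝ) ≤ 2 * (F.L : ℝ) ^ 2 := by positivity
  calc θBal F.L γ 𝔠.b₀ 𝔠.p₀ (K - j) ≤ 2 * (F.L : ℝ) ^ 2 * θBal F.L γ 𝔠.b₀ 𝔠.p₀ (K - j + 1) := hmono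
    _ = 2 * (F.L : ℝ) ^ 2 * 1 * θBal F.L γ 𝔠.b₀ 𝔠.p₀ (K - j + 1) := by ring
    _ ≤ 2 * (F.L : ℝ) ^ 2 * avgWindowFactor F.L * θBal F.L γ 𝔠.b₀ 𝔠.p₀ (K - j + 1) :=
        mul_le_mul_of_nonneg_right (mul_le_mul_of_nonneg_left hB hL2) hθ

/-! ## §3 The upper sandwich, the interior characteristic function, the sizes, the bookkeeping -/

/-- Data rows of the core at every `k ≤ K` (steps below the top, terminal row at the top): `U_k(·,h)` measurable, `Pint_k(h,·)` measurable and `≤ cP_k`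
(`AlphaInputsT3ACv3` §3's `measurable_UkH`/`measurable_Pint`/`Pint_le`, read off the core's fields). [cite: Balaban1985UV3, (42)–(43) p.266 and (46) p.267] -/
theorem AlphaInputsT3AC.dataIntV3_dataRows (K k : ℕ) (hk : k ≤ K) (h : Hist (F.P K) k) :
    Measurable ((q K).UkH k h) ∧ Measurable ((inputOfAC 𝔠.lane (q K).X (q K).𝔖).Pint k h) ∧
      ∀ U : GaugeField (F.P K) k (Matrix.specialUnitaryGroup (Fin 2) ℂ), (inputOfAC 𝔠.lane (q K).X (q K).𝔖).Pint k h U ≤ (q K).𝔄.cP k := by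
  rcases Nat.lt_or_eq_of_le hk with hlt | rfl
  · exact ⟨((q K).runCore.steps k hlt).hU h, ((q K).runCore.steps k hlt).hPm h, fun U => ((q K).runCore.steps k hlt).hPb h U⟩
  · exact ⟨(q _).termRows.1 h, (q _).termRows.2.1 h, fun U => (q _).termRows.2.2 h U⟩

/-- **`χ_j` IS THE INDICATOR OF THE INTERIOR WINDOW** (definitional). [cite: Balaban1985Variational, Thm 1 (8) p.279] -/
theorem AlphaInputsT3AC.dataIntV3_chi_eq (K j : ℕ) (W : GaugeField (F.P K) j (Matrix.specialUnitaryGroup (Fin 2) ℂ)) :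
    (AlphaInputsT3AC.dataIntV3 q π).χ K j W =
      {V : GaugeField (F.P K) j (Matrix.specialUnitaryGroup (Fin 2) ℂ) |
        PlaqSmall (θBal F.L γ 𝔠.b₀ 𝔠.p₀ (K - j) / max 𝔠.B₃ 1) V}.indicator (fun _ => (1 : ℝ)) W :=
  rfl

/-- **`ChiRange`**: the indicator takes values in `[0, 1]`. [folklore] -/
theorem AlphaInputsT3AC.dataIntV3_chiRange : ChiRange (AlphaInputsT3AC.dataIntV3 q π) := by
  intro K j W
  rw [AlphaInputsT3AC.dataIntV3_chi_eq q π K j W]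
  by_cases hW : W ∈ {V : GaugeField (F.P K) j (Matrix.specialUnitaryGroup (Fin 2) ℂ) |
      PlaqSmall (θBal F.L γ 𝔠.b₀ 𝔠.p₀ (K - j) / max 𝔠.B₃ 1) V}
  · rw [Set.indicator_of_mem hW]; norm_num
  · rw [Set.indicator_of_notMem hW]; norm_num

/-- `χ_j(W) = 1` on the interior window. [cite: Balaban1985Variational, Thm 1 (8) p.279] -/
theorem AlphaInputsT3AC.dataIntV3_chi_eq_one_of_plaqSmall (K j : ℕ)
    (W : GaugeField (F.P K) j (Matrix.specialUnitaryGroup (Fin 2) ℂ)) (hW : PlaqSmall (θBal F.L γ 𝔠.b₀ 𝔠.p₀ (K - j) / max 𝔠.B₃ 1) W) :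
    (AlphaInputsT3AC.dataIntV3 q π).χ K j W = 1 := by
  rw [AlphaInputsT3AC.dataIntV3_chi_eq q π K j W]
  exact Set.indicator_of_mem (by exact hW) _

/-- `χ_j(W) = 0` off the interior window. [folklore] -/
theorem AlphaInputsT3AC.dataIntV3_chi_eq_zero_of_not_plaqSmall (K j : ℕ)
    (W : GaugeField (F.P K) j (Matrix.specialUnitaryGroup (Fin 2) ℂ)) (hW : ¬ PlaqSmall (θBal F.L γ 𝔠.b₀ 𝔠.p₀ (K - j) / max 𝔠.B₃ 1) W) :
    (AlphaInputsT3AC.dataIntV3 q π).χ K j W = 0 := by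
  rw [AlphaInputsT3AC.dataIntV3_chi_eq q π K j W]
  exact Set.indicator_of_notMem (by exact hW) _

/-- On the interior window the minorant is positive: `0 < low_j(W)`. [cite: Balaban1985UV3, (47) p.267] -/
theorem AlphaInputsT3AC.dataIntV3_low_pos_of_plaqSmall (K j : ℕ)
    (W : GaugeField (F.P K) j (Matrix.specialUnitaryGroup (Fin 2) ℂ)) (hW : PlaqSmall (θBal F.L γ 𝔠.b₀ 𝔠.p₀ (K - j) / max 𝔠.B₃ 1) W) :
    0 < (AlphaInputsT3AC.dataIntV3 q π).low K j W := by
  unfold AlphaDataT3.low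
  rw [AlphaInputsT3AC.dataIntV3_chi_eq_one_of_plaqSmall q π K j W hW, one_mul]
  exact Real.exp_pos _

include q in
/-- The interior radius is positive and at most `θBal(K − j)`, `j ≤ K`. [cite: Balaban1985Variational, Thm 1 (8) p.279] -/
theorem AlphaInputsT3AC.dataIntV3_intRadius_pos_le (K j : ℕ) (hj : j ≤ K) :
    0 < θBal F.L γ 𝔠.b₀ 𝔠.p₀ (K - j) / max 𝔠.B₃ 1 ∧ θBal F.L γ 𝔠.b₀ 𝔠.p₀ (K - j) / max 𝔠.B₃ 1 ≤ θBal F.L γ 𝔠.b₀ 𝔠.p₀ (K - j) := by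
  have hθ := AlphaInputsT3AC.dataIntV3_θBal_pos q K j hj
  have hB1 : 1 ≤ max 𝔠.B₃ 1 := le_max_right _ _
  exact ⟨div_pos hθ (lt_of_lt_of_le one_pos hB1), div_le_self hθ.le hB1⟩

/-- The majorant is nonnegative: `0 ≤ up_j(W)`. [folklore] -/
theorem AlphaInputsT3AC.dataIntV3_up_nonneg (K j : ℕ) (W : GaugeField (F.P K) j (Matrix.specialUnitaryGroup (Fin 2) ℂ)) :
    0 ≤ (AlphaInputsT3AC.dataIntV3 q π).up K j W :=
  Finset.sum_nonneg fun r _ => mul_nonneg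
    (PinnedStep.wtP_nonneg_le 𝔠.lane (q K).X (AlphaInputsT3AC.admWindowT3 F 𝔠 γ hγ hγ1 K) j r W).1 (Real.exp_pos _).le

/-- **`TrivRegions`** (`Carriers.Omega_triv`). [cite: Balaban1985UV3, (47) p.267 and p.272] -/
theorem AlphaInputsT3AC.dataIntV3_trivRegions : TrivRegions (AlphaInputsT3AC.dataIntV3 q π) := fun _ j i =>
  Omega_triv _ _ j i

/-- **The `EcstBook` identity**: `Ecst K j = −Σ_{i<j} Estep K i` for `j ≤ K` ((64) and `E = E_0`; `PkgAtV3.Ecst_sub_E_eq`'s proof). [cite: Balaban1985UV3, (62) p.271 and (64) p.273] -/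
theorem AlphaInputsT3AC.dataIntV3_Ecst_eq (K j : ℕ) (hj : j ≤ K) :
    (AlphaInputsT3AC.dataIntV3 q π).Ecst K j = -∑ i ∈ Finset.range j, (AlphaInputsT3AC.dataIntV3 q π).Estep K i := by
  have h1 : (q K).T.Ecst j = ∑ i ∈ Finset.Ico j K, (q K).T.Estep i := (q K).T.Ecst_eq j
  have h2 : (q K).E = ∑ i ∈ Finset.Ico 0 K, (q K).T.Estep i := rfl
  show (q K).T.Ecst j - (q K).E = -∑ i ∈ Finset.range j, (q K).T.Estep i
  rw [h1, h2, Finset.range_eq_Ico, ← Finset.sum_Ico_consecutive _ (Nat.zero_le j) hj]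
  ring

/-- **THE REMAINDER, CLOSED FORM** (`PkgAtV3.Rm_eq`'s proof over the core): `Rm_j = r⋆·γ^{3+κ₀}·(Σ_{i<j} q^{K−i})·(2L^m)³`, `q = L^{−κ₀}`, `j ≤ K`. [cite: Balaban1985UV3, (41) p.266] -/
theorem AlphaInputsT3AC.dataIntV3_Rm_eq (K j : ℕ) (hj : j ≤ K) :
    (AlphaInputsT3AC.dataIntV3 q π).Rm K j = 𝔠.stepConsts.rstar * γ ^ (3 + 𝔠.κ₀) *
      (∑ i ∈ Finset.range j, (((F.L : ℝ)⁻¹) ^ 𝔠.κ₀) ^ (K - i)) * (2 * (F.L : ℝ) ^ F.m) ^ 3 := by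
  have hg2 : (T3Scales F γ hγ (hγ1.trans (sq_min_one_le _ 𝔠.gamma0_pos)) K).g ^ 2 = γ := Real.sq_sqrt hγ.le
  show ∑ i ∈ Finset.range j, rcoefOf _ 𝔠.lane.carrier i *
      ((F.L : ℝ) ^ i * (T3Scales F γ hγ (hγ1.trans (sq_min_one_le _ 𝔠.gamma0_pos)) K).ε) ^ (3 + 𝔠.κ₀) *
        (T3Scales F γ hγ (hγ1.trans (sq_min_one_le _ 𝔠.gamma0_pos)) K).sites i = _
  rw [Finset.mul_sum, Finset.sum_mul]
  refine Finset.sum_congr rfl fun i hi => ?_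
  have hiK : i ≤ K := (Finset.mem_range.mp hi).le.trans hj
  rw [rcoefOf_carrier, hg2, mul_assoc,
    rem_unit_T3Scales F γ hγ (hγ1.trans (sq_min_one_le _ 𝔠.gamma0_pos)) K 𝔠.κ₀ i hiK]
  show 𝔠.stepConsts.rstar * γ ^ (3 + 𝔠.κ₀) * ((((F.L : ℝ)⁻¹) ^ 𝔠.κ₀) ^ (K - i) * (2 * (F.L : ℝ) ^ F.m) ^ 3) = _
  ring

/-- **`RmSize`** with `C = r⋆γ^{3+κ₀}`, `q = L^{−κ₀}`: extensive in the PHYSICAL volume only, uniform in the cut-off. [cite: Balaban1985UV3, (41) p.266 and (5) p.256] -/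
theorem AlphaInputsT3AC.dataIntV3_rmSize :
    RmSize (AlphaInputsT3AC.dataIntV3 q π) (𝔠.stepConsts.rstar * γ ^ (3 + 𝔠.κ₀)) (((F.L : ℝ)⁻¹) ^ 𝔠.κ₀) := by
  have hL1 : (1 : ℝ) < F.L := by exact_mod_cast F.hL.2
  have hLi : (0 : ℝ) ≤ (F.L : ℝ)⁻¹ := inv_nonneg.mpr (zero_lt_one.trans hL1).le
  have hq0 : 0 ≤ ((F.L : ℝ)⁻¹) ^ 𝔠.κ₀ := Real.rpow_nonneg hLi _
  refine ⟨hq0, Real.rpow_lt_one hLi (inv_lt_one_of_one_lt₀ hL1) 𝔠.κ₀_pos, fun K j hj => ?_⟩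
  have heq := AlphaInputsT3AC.dataIntV3_Rm_eq q π K j hj
  refine ⟨?_, heq.le⟩
  rw [heq]
  have h3 : 0 ≤ ∑ i ∈ Finset.range j, (((F.L : ℝ)⁻¹) ^ 𝔠.κ₀) ^ (K - i) := Finset.sum_nonneg fun i _ => pow_nonneg hq0 _
  have h4 : 0 ≤ (2 * (F.L : ℝ) ^ F.m) ^ 3 := by positivity
  exact mul_nonneg (mul_nonneg (mul_nonneg 𝔠.stepConsts.rstar_nonneg (Real.rpow_nonneg hγ.le _)) h3) h4

end Delivered

end Summit.QuantumFields.YangMills.Theorems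

end
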